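import Mathlib
import Summits.Ventures.HodgeRepro.Tier4.Common.AdelicDefs
import Summits.Ventures.HodgeRepro.Tier4.Common.AdelicRTF
import Summits.Ventures.HodgeRepro.Tier4.Line1.AdelicParts
import Summits.Ventures.HodgeRepro.Tier4.Line1.FiniteLevelIsolation
import Summits.Ventures.HodgeRepro.Tier4.Line4.FinitePlacePositivity

/-!
# Tier4/Line4/FinitePartSplit — the archimedean part of a torus element, and the split of a character along
`t = t_∞ · t_f`

Blind re-derivation cell `pub-hodge-repro`, Tier 4 «PROVE THE STEP» (README §9–§10), LINE L4; consumer-side helper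
for C-L4-FINPOS (t4-plan-4 g2 S14158: «the archimedean factor `χ_∞(t_∞) χ̄′_∞(t′_∞)` is then WFIBRE's, cleanly
separated by `R.chi t = R.chi (ofInfPart t) * R.chi (ofFinPart t)` (`chi_mul` + `GA.ofInfPart_mul_ofFinPart`)»);
seat t4-L2-p3 (gen 3).

* `ofInfPart_mem_commutant`, `ofInfPart_mem_torusT`, `ofInfPart_mem_torusT'`: the archimedean part of an element of a
  commutant / of `T` / of `T′` lies in it (entrywise projection, the twin of `ofFinPart_mem_torusT`); `infT`, `infT'`
  are the induced self-maps of the tori;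
* `eq_infT_mul_finT`, `eq_infT'_mul_finT'`: `t = t_∞ · t_f` inside the torus (`GA.ofInfPart_mul_ofFinPart`);
* **`chi_eq_chi_infT_mul_chi_finT`**, **`chi'_eq_chi'_infT'_mul_chi'_finT'`**: `χ(t) = χ(t_∞) · χ(t_f)` and
  `χ′(t′) = χ′(t′_∞) · χ′(t′_f)` (`RTFData.chi_mul` / `chi'_mul`) — so the character product of a pair splits as
  `(χ(t_∞) conj χ′(t′_∞)) · (χ(t_f) conj χ′(t′_f))`, the second factor being the one `exists_level_re_pos_of_regular`
  makes positive (`chi_mul_conj_chi'_eq_inf_mul_fin`).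

No printed input is consumed; nothing here asserts anything about the truth of (P); HC_CM is NOT proved by anyone in
this repository.
-/

set_option autoImplicit false

noncomputable section

namespace Summit.Ventures.HodgeRepro.Tier4.Line4

open Summit.Ventures.HodgeRepro.Tier4 Summit.Ventures.HodgeRepro.Tier4.Common
  Summit.Ventures.HodgeRepro.Tier4.Line1
open scoped ComplexConjugate

variable {k : Type} [Field k] [NumberField k] (W : PlaneData k)

/-- The archimedean part of an element of a commutant lies in the commutant (entrywise projection). -/
theorem ofInfPart_mem_commutant (A : Matrix (Fin 4) (Fin 4) k) {g : GA W} (hg : g ∈ commutant W A) :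
    GA.ofInfPart W g ∈ commutant W A := by
  have hg' : GA.mat W g * adMat k A = adMat k A * GA.mat W g := hg
  change GA.mat W (GA.ofInfPart W g) * adMat k A = adMat k A * GA.mat W (GA.ofInfPart W g)
  rw [GA.mat_ofInfPart]
  apply M4_ext
  · have h2 := congrArg (infM k) hg'
    rw [infM_mul, infM_mul] at h2
    simp only [infM_mul, infM_mixM]
    exact h2
  · simp only [finM_mul, finM_mixM, Matrix.one_mul, Matrix.mul_one]

/-- The archimedean part of an element of `T` lies in `T`. -/
theorem ofInfPart_mem_torusT {g : GA W} (hg : g ∈ torusT W) : GA.ofInfPart W g ∈ torusT W :=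
  Subgroup.mem_inf.2 ⟨ofInfPart_mem_commutant W _ (Subgroup.mem_inf.1 hg).1,
    ofInfPart_mem_commutant W _ (Subgroup.mem_inf.1 hg).2⟩

/-- The archimedean part of an element of `T′` lies in `T′`. -/
theorem ofInfPart_mem_torusT' {g : GA W} (hg : g ∈ torusT' W) : GA.ofInfPart W g ∈ torusT' W :=
  Subgroup.mem_inf.2 ⟨ofInfPart_mem_commutant W _ (Subgroup.mem_inf.1 hg).1,
    ofInfPart_mem_commutant W _ (Subgroup.mem_inf.1 hg).2⟩

/-- The archimedean part of an element of `T`, as an element of `T`. -/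
def infT (t : torusT W) : torusT W := ⟨GA.ofInfPart W t, ofInfPart_mem_torusT W t.2⟩

/-- The archimedean part of an element of `T′`, as an element of `T′`. -/
def infT' (t : torusT' W) : torusT' W := ⟨GA.ofInfPart W t, ofInfPart_mem_torusT' W t.2⟩

/-- `t = t_∞ · t_f` in `T`. -/
theorem eq_infT_mul_finT (t : torusT W) : t = infT W t * finT W t :=
  Subtype.ext (GA.ofInfPart_mul_ofFinPart W (t : GA W)).symm

/-- `t′ = t′_∞ · t′_f` in `T′`. -/
theorem eq_infT'_mul_finT' (t : torusT' W) : t = infT' W t * finT' W t :=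
  Subtype.ext (GA.ofInfPart_mul_ofFinPart W (t : GA W)).symm

variable [MeasurableSpace (torusT W)] [MeasurableSpace (torusT' W)]

/-- **The character splits along `t = t_∞ · t_f`**: `χ(t) = χ(t_∞) · χ(t_f)`. -/
theorem chi_eq_chi_infT_mul_chi_finT (R : RTFData W) (t : torusT W) :
    R.chi t = R.chi (infT W t) * R.chi (finT W t) := by
  calc R.chi t = R.chi (infT W t * finT W t) := congrArg R.chi (eq_infT_mul_finT W t)
    _ = R.chi (infT W t) * R.chi (finT W t) := R.chi_mul _ _

/-- **The character splits along `t′ = t′_∞ · t′_f`**: `χ′(t′) = χ′(t′_∞) · χ′(t′_f)`. -/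
theorem chi'_eq_chi'_infT'_mul_chi'_finT' (R : RTFData W) (t : torusT' W) :
    R.chi' t = R.chi' (infT' W t) * R.chi' (finT' W t) := by
  calc R.chi' t = R.chi' (infT' W t * finT' W t) := congrArg R.chi' (eq_infT'_mul_finT' W t)
    _ = R.chi' (infT' W t) * R.chi' (finT' W t) := R.chi'_mul _ _

/-- **The character product of a pair splits into its archimedean and finite factors**:
`χ(t) conj χ′(t′) = (χ(t_∞) conj χ′(t′_∞)) · (χ(t_f) conj χ′(t′_f))` — the second factor is the one
`exists_level_re_pos_of_regular` makes positive at a deep level. -/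
theorem chi_mul_conj_chi'_eq_inf_mul_fin (R : RTFData W) (t : torusT W) (t' : torusT' W) :
    R.chi t * conj (R.chi' t') =
      (R.chi (infT W t) * conj (R.chi' (infT' W t'))) * (R.chi (finT W t) * conj (R.chi' (finT' W t'))) := by
  rw [chi_eq_chi_infT_mul_chi_finT W R t, chi'_eq_chi'_infT'_mul_chi'_finT' W R t', map_mul]
  ring

end Summit.Ventures.HodgeRepro.Tier4.Line4

end
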